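import Summits.AtomisticToContinuum.Crystallization.Theorems.UniformBindingRigidity.Negative.LoadBearing

/-!
# Negative knowledge for crux `PerronTransitivity.TransitiveLocalLimit` (stmt-AtomisticToContinuum-15100), I:
# the minimality hypothesis is load-bearing; the singleton limit is excluded

Refuter vetting (cdisprove, `--supports stmt-AtomisticToContinuum-15100`). The crux reads
`∀ x, (∀ N, IsGroundState V_LJ (x N)) → ∃ X σ τ, X.Nonempty ∧ (X uniformly discrete) ∧ StrictMono σ ∧
(two-way ε-matching of x (σ j) + τ j with X on every ball ‖·‖ ≤ R, eventually in j) ∧ ∀ p ∈ X, U_X(p) = 2E*`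
with `U_X(p) = ∑'_{q ∈ X, q ≠ p} V_LJ(dist p q)`, `E* = ⨅_Q e_LJ(Q)`, and `IsGroundState = Injective ∧ (energy = E(N))`.

* `transitiveLocalLimit_false_without_minimality` — the crux with the energy-minimality half of `IsGroundState`
  dropped (only injectivity of each `x N` kept; that weakening trivially implies the crux,
  `fun h x hx => h x fun N => (hx N).1`) **is FALSE**: for the spread-out collinear configurations
  `x N i = (N·i)·e₀` every admissible local limit `X` is a singleton (two points of `X` would have to be matched,
  at a late stage `j`, by two particles at mutual distance `≥ σ j → ∞`), and a singleton has the empty site sum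
  `0 ≠ 2E*` (`2E* ≤ −1`, tree). So ANY proof of the crux must use that the `x N` minimise the energy — the
  matching/separation/non-emptiness clauses carry no energetic information by themselves.
* `singleton_not_transitive` — the degenerate witness `X = {p}` can never be the transitive limit (site sum `0`).
All `[folklore]`.
-/

noncomputable section

namespace Summit.AtomisticToContinuum.Crystallization.Theorems.TransitiveLocalLimit.Negative.LoadBearing

open Filter
open Literature.MathematicalPhysics.StatisticalMechanics
open Summit.AtomisticToContinuum.Crystallization.Theorems.UniformBindingRigidity.Negative.LoadBearing
  (two_mul_iInf_le_neg_one)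

/-! ## The witness: spread-out collinear configurations `x N i = (N·i)·e₀` -/

/-- Mutual distances of the spread-out collinear configuration: `dist = N·|i − j|`. [folklore] -/
theorem dist_spread (N : ℕ) (i j : Fin N) :
    dist ((((N : ℝ) * ((i : ℕ) : ℝ)) • EuclideanSpace.single (0 : Fin 3) (1 : ℝ)))
      ((((N : ℝ) * ((j : ℕ) : ℝ)) • EuclideanSpace.single (0 : Fin 3) (1 : ℝ))) =
      (N : ℝ) * |((i : ℕ) : ℝ) - ((j : ℕ) : ℝ)| := by
  rw [dist_eq_norm, ← sub_smul, norm_smul, PiLp.norm_single, norm_one, mul_one, ← mul_sub,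
    Real.norm_eq_abs, abs_mul, abs_of_nonneg (Nat.cast_nonneg N)]

/-- Distinct particles of the spread-out configuration are at distance `≥ N`. [folklore] -/
theorem le_dist_spread {N : ℕ} {i j : Fin N} (h : i ≠ j) :
    (N : ℝ) ≤ dist ((((N : ℝ) * ((i : ℕ) : ℝ)) • EuclideanSpace.single (0 : Fin 3) (1 : ℝ)))
      ((((N : ℝ) * ((j : ℕ) : ℝ)) • EuclideanSpace.single (0 : Fin 3) (1 : ℝ))) := by
  rw [dist_spread]
  have h1 : (1 : ℝ) ≤ |((i : ℕ) : ℝ) - ((j : ℕ) : ℝ)| := by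
    rcases lt_or_gt_of_ne (Fin.val_ne_of_ne h) with hlt | hlt
    · have : ((i : ℕ) : ℝ) + 1 ≤ ((j : ℕ) : ℝ) := by exact_mod_cast hlt
      rw [abs_sub_comm, abs_of_nonneg (by linarith)]
      linarith
    · have : ((j : ℕ) : ℝ) + 1 ≤ ((i : ℕ) : ℝ) := by exact_mod_cast hlt
      rw [abs_of_nonneg (by linarith)]
      linarith
  nlinarith [Nat.cast_nonneg (α := ℝ) N]

/-- Each spread-out configuration consists of distinct points. [folklore] -/
theorem spread_injective (N : ℕ) :
    Function.Injective fun i : Fin N => (((N : ℝ) * ((i : ℕ) : ℝ)) • EuclideanSpace.single (0 : Fin 3) (1 : ℝ)) := by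
  intro i j hij
  by_contra h
  have hle := le_dist_spread h
  simp only at hij
  rw [hij, dist_self] at hle
  have hN : N = 0 := by exact_mod_cast le_antisymm hle (Nat.cast_nonneg N)
  subst hN
  exact i.elim0

/-! ## Excluded degenerate limit -/

/-- **A singleton is never the transitive limit**: its site sum is the empty `tsum = 0 ≠ 2E*`
(`2E* ≤ −1`). [folklore] -/
theorem singleton_not_transitive {X : Set (EuclideanSpace ℝ (Fin 3))} {p : EuclideanSpace ℝ (Fin 3)} (hp : p ∈ X) (hX : ∀ q ∈ X, q = p) :
    ∑' q : {q : EuclideanSpace ℝ (Fin 3) // q ∈ X ∧ q ≠ p}, lennardJones (dist p q.1) ≠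
      2 * ⨅ Q : PeriodicConfiguration 3, Q.energyPerParticle lennardJones := by
  haveI : IsEmpty {q : EuclideanSpace ℝ (Fin 3) // q ∈ X ∧ q ≠ p} := ⟨fun q => q.2.2 (hX q.1 q.2.1)⟩
  rw [tsum_empty]
  have := two_mul_iInf_le_neg_one
  have _ := hp
  intro h0
  linarith

/-! ## Minimality is load-bearing -/

/-- **The crux is FALSE without energy minimality** (witness: the spread-out collinear configurations; every admissible
local limit is a singleton, whose site sum is `0 ≠ 2E*`). [folklore] -/
theorem transitiveLocalLimit_false_without_minimality :
    ¬ (∀ x : (N : ℕ) → (Fin N → EuclideanSpace ℝ (Fin 3)), (∀ N, Function.Injective (x N)) →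
        ∃ (X : Set (EuclideanSpace ℝ (Fin 3))) (σ : ℕ → ℕ) (τ : ℕ → EuclideanSpace ℝ (Fin 3)), X.Nonempty ∧
          (∃ δ : ℝ, 0 < δ ∧ ∀ p ∈ X, ∀ q ∈ X, p ≠ q → δ ≤ dist p q) ∧ StrictMono σ ∧
          (∀ R ε : ℝ, 0 < ε → ∀ᶠ j : ℕ in Filter.atTop,
            (∀ p ∈ X, ‖p‖ ≤ R → ∃ i : Fin (σ j), dist (x (σ j) i + τ j) p ≤ ε) ∧
            (∀ i : Fin (σ j), ‖x (σ j) i + τ j‖ ≤ R → ∃ p ∈ X, dist (x (σ j) i + τ j) p ≤ ε)) ∧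
          ∀ p ∈ X, ∑' q : {q : EuclideanSpace ℝ (Fin 3) // q ∈ X ∧ q ≠ p},
            Literature.MathematicalPhysics.StatisticalMechanics.lennardJones (dist p q.1) =
            2 * ⨅ Q : Literature.MathematicalPhysics.StatisticalMechanics.PeriodicConfiguration 3,
              Q.energyPerParticle Literature.MathematicalPhysics.StatisticalMechanics.lennardJones) := by
  intro h
  obtain ⟨X, σ, τ, ⟨p, hp⟩, ⟨δ, hδ, hsep⟩, hσ, hmatch, hU⟩ :=
    h (fun N i => (((N : ℝ) * ((i : ℕ) : ℝ)) • EuclideanSpace.single (0 : Fin 3) (1 : ℝ))) spread_injective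
  set spread : (N : ℕ) → Fin N → EuclideanSpace ℝ (Fin 3) :=
    fun N i => (((N : ℝ) * ((i : ℕ) : ℝ)) • EuclideanSpace.single (0 : Fin 3) (1 : ℝ)) with hspread
  by_cases hX : ∃ q ∈ X, q ≠ p
  · obtain ⟨q, hq, hqp⟩ := hX
    have hpq : δ ≤ dist p q := hsep p hp q hq (Ne.symm hqp)
    have hev := hmatch (max ‖p‖ ‖q‖) (δ / 3) (by positivity)
    have hev2 : ∀ᶠ j : ℕ in atTop, dist p q + δ < ((σ j : ℕ) : ℝ) :=
      (tendsto_natCast_atTop_atTop.comp hσ.tendsto_atTop).eventually_gt_atTop (dist p q + δ)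
    obtain ⟨j, ⟨h1, -⟩, h2⟩ := (hev.and hev2).exists
    obtain ⟨i, hi⟩ := h1 p hp (le_max_left _ _)
    obtain ⟨i', hi'⟩ := h1 q hq (le_max_right _ _)
    by_cases hii' : i = i'
    · subst hii'
      have : dist p q ≤ δ / 3 + δ / 3 :=
        calc dist p q ≤ dist p (spread (σ j) i + τ j) + dist (spread (σ j) i + τ j) q := dist_triangle _ _ _
          _ ≤ δ / 3 + δ / 3 := by rw [dist_comm p]; exact add_le_add hi hi'
      linarith
    · have hfar : ((σ j : ℕ) : ℝ) ≤ dist (spread (σ j) i + τ j) (spread (σ j) i' + τ j) := by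
        rw [dist_add_right, hspread]
        exact le_dist_spread hii'
      have hnear : dist (spread (σ j) i + τ j) (spread (σ j) i' + τ j) ≤ δ / 3 + (dist p q + δ / 3) :=
        calc dist (spread (σ j) i + τ j) (spread (σ j) i' + τ j)
            ≤ dist (spread (σ j) i + τ j) p + dist p (spread (σ j) i' + τ j) := dist_triangle _ _ _
          _ ≤ dist (spread (σ j) i + τ j) p + (dist p q + dist q (spread (σ j) i' + τ j)) := by
              gcongr; exact dist_triangle _ _ _
          _ ≤ δ / 3 + (dist p q + δ / 3) := by
              rw [dist_comm q]; exact add_le_add hi (add_le_add le_rfl hi')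
      linarith
  · push Not at hX
    exact singleton_not_transitive hp hX (hU p hp)

end Summit.AtomisticToContinuum.Crystallization.Theorems.TransitiveLocalLimit.Negative.LoadBearing

end
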